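import Literature.Analysis.FluidPDE.LocalTypeI
import Literature.Analysis.FluidPDE.Vorticity
import Literature.Analysis.FluidPDE.ContinuousAlignmentTypeI
import HarnessLib

/-!
# Giga–Miura 2011, §2.2: the local continuous-alignment criterion under local Type I
# (Definition 2.9, Theorem 2.10)

Topic `Analysis/FluidPDE`. Source: Y. Giga, H. Miura, *On vorticity directions near singularities
for the Navier–Stokes flows with infinite energy*, Comm. Math. Phys. **303** (2011) 289–300
[GigaMiura2011]; numbering and pages of the submitted text, Hokkaido University Preprint Series in
Mathematics **#956** (2010), which we hold in full (lit key `paper:url-45d04fdad14a`; render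
`run/shared/lean/pub/ns-regularity-ideate/ns-regularity-ideate-lit/renders/GM11-HokkaidoPreprint956-full/`,
pp. 10–11): §2.2 "Local regularity", **Definition 2.9** and **Theorem 2.10** (p. 10),
**Remark 2.11** (p. 11). The CMP numbering of §2 is not independently verified (acq-10949 open).
Companions: `ContinuousAlignmentTypeI` (Theorem 1.1, whole space) and
`GigaMiura2011BlowupAnalysis` (§2.1: Props 2.1–2.2, Lemma 2.3, Cor 2.4, Thm 1.1 under (CA′)).

Cited by the N0 route `Summit.NavierStokesRegularity.NavierStokesRegularity.Theses.LocalSineTubeDoor`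
as the nearest PRINTED local criterion ("Giga–Miura 2011 Thm 1.1 / Rmk 1.4 (CA′) / Thm 2.10"): the
printed local theorem assumes alignment with a FIXED modulus on the whole fixed-level set
`{|ω| > d} ∩ B(r₀)` and Type I on `B(r₀)`; the route's leaf assumes sine (sign-blind) coherence on
ONE similarity window above a scale-critical threshold.

## What is printed (HUPS #956 p. 10, verbatim up to notation)

**Definition 2.9.** "Let `B(r)` be a ball centered at the origin with radius `r > 0` and
`Q = B(1) × (−1, 0)` be a unit parabolic cylinder in `ℝ³ × (−1, 0)`. We say the pair `u` and `p` is
a suitable weak solution of (NS) in `Q` if … `u ∈ L^∞(−1, 0; L²(B(1))) ∩ L²(−1, 0; W^{1,2}(B(1)))`,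
`p ∈ L^{3/2}(−1, 0; L^{3/2}(B(1)))`, and `(u, p)` satisfies (NS) in the sense of distributions and
the local energy inequality … for all nonnegative functions `φ ∈ C_0^∞(Q)` and almost all
`t ∈ (−1, 0)`."

**Theorem 2.10.** "Let `(u, p)` be a suitable weak solution for (NS) on `B(1) × (−1, 0)`
satisfying `‖u‖_{L^∞(B(r₀))}(t) ≤ C₀(−t)^{−1/2}` with some positive constants `r₀ ∈ (0, 1)` and
`C₀ > 0` independent of `t ∈ (−1, 0)`. For a given `d > 0` let `η` be a modulus such that
`|ζ(x, t) − ζ(y, t)| ≤ η(|x − y|)` for all `x, y ∈ Ω_d(t)`, `t ∈ (−1, 0)` (D), where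
`Ω_d(t) = {x ∈ B(r₀); |ω(x, t)| > d}`. Then `u` is regular at `(x, t) = (0, 0)`."

**Remark 2.11.** "We do not prove Theorem 2.10 because it is almost parallel as the proof of
Theorem 1.1. The only difference is the compactness argument … we invoke a result in Seregin and
Sverak [SS, Theorem 2.8] … We notice that since local existence theory in general domains is not
known, it is not easy to weaken the assumption of the vorticity directions as (CA′) in the local
case."

## Rendering choices

* Definition 2.9's class on `Q = B(1) × (−1, 0)` is EXACTLY the accepted
  `IsSuitableWeakSolutionInBall 1 (0, 0) u p` (`LocalTypeI`; Albritton–Barker 2019 Def. 2.1 =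
  CKN/Lin suitable weak solution on the parabolic ball together with the global class
  `u ∈ L^∞_t L²_x(Q)`, `∇u ∈ L²(Q)` through a weak spatial gradient, `p ∈ L^{3/2}(Q)`); it is not
  re-declared.
* Under the local Type I bound `u` is essentially bounded, hence smooth, inside `B(r₀) × (−1, t]`
  for every `t < 0` (interior regularity of bounded suitable weak solutions), and Theorem 2.10
  tacitly evaluates `ω = curl u` and `ζ = ω/|ω|` pointwise there. We state the theorem for a
  representative `u` whose slices are `C¹` on `B(r₀)`, with the Type I bound pointwise on
  `B(r₀) × (−1, 0)` (for the continuous representative this is the printed `L^∞(B(r₀))` bound):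
  additional hypotheses, so the named fact is implied by the printed theorem.
* `η` a modulus as in Remark 1.2 (non-decreasing, continuous on `[0, ∞)`, `η(0) = 0`);
  `ζ = vorticityDirection (curl (u t))`. "`u` is regular at `(0, 0)`" (Seregin–Šverák's notion,
  [SS] §3, which §2.2 follows: essentially bounded on some `Q(r)`) is rendered one-sidedly in time
  as essential boundedness on a backward parabolic cylinder `parabolicCylinder r (0, 0)`, `r > 0`,
  exactly as in the barrier `Literature.Barriers.NavierStokesRegularity.AxisymmetricTypeIExclusion`.
* `ν = 1` as printed (the class `IsSuitableWeakSolutionInBall` has unit viscosity).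

## What is NOT here

No proof (the source itself gives none beyond Remark 2.11; the whole-space argument is §2.1,
`GigaMiura2011BlowupAnalysis`); §3 (boundary effects).

## References

* Y. Giga, H. Miura, Comm. Math. Phys. 303 (2011) 289–300 = Hokkaido Univ. Preprint #956 (2010),
  §2.2, Def. 2.9, Thm 2.10, Rmk 2.11 (pp. 10–11). [GigaMiura2011]
* G. Seregin, V. Šverák, Comm. PDE 34 (2009) 171–201 (= [SS]: Thm 2.8, the compactness quoted in
  Rmk 2.11; §3, regular points). [SereginSverak2009]
* D. Albritton, T. Barker, Arch. Ration. Mech. Anal. 232 (2019), Def. 2.1 (the class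
  `IsSuitableWeakSolutionInBall`). [AlbrittonBarker2019]
-/

noncomputable section

open MeasureTheory Set Function Filter Metric
open _root_.Topology
open scoped ENNReal

namespace Literature.Analysis.FluidPDE

/-- **Giga–Miura 2011, Theorem 2.10** (local continuous-alignment criterion under local Type I;
HUPS #956 p. 10 = CMP 303 §2.2: "Let `(u, p)` be a suitable weak solution for (NS) on
`B(1) × (−1, 0)` satisfying `‖u‖_{L^∞(B(r₀))}(t) ≤ C₀(−t)^{−1/2}` with some positive constants
`r₀ ∈ (0, 1)` and `C₀ > 0` independent of `t ∈ (−1, 0)`. For a given `d > 0` let `η` be a modulus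
such that `|ζ(x, t) − ζ(y, t)| ≤ η(|x − y|)` for all `x, y ∈ Ω_d(t)`, `t ∈ (−1, 0)` (D), where
`Ω_d(t) = {x ∈ B(r₀); |ω(x, t)| > d}`. Then `u` is regular at `(x, t) = (0, 0)`."). Rendering
(module docstring): the suitable class of Definition 2.9 is `IsSuitableWeakSolutionInBall 1 (0,0)`;
the slices of the representative `u` are `C¹` on `B(r₀)` and obey the Type I bound
`√(−t)‖u(t,x)‖ ≤ C₀` pointwise there (extra hypotheses); (D) with `ω = curl (u t)`,
`ζ = vorticityDirection ω`; conclusion: `u` is essentially bounded on a backward parabolic cylinder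
`Q_r(0, 0)`, `r > 0`. Not proved in the source beyond Remark 2.11 ("almost parallel as the proof of
Theorem 1.1", compactness from [SS, Thm 2.8]); nothing is asserted; users take
`(h : gigaMiura2011_local_continuousAlignment_typeI)`. [cite: GigaMiura2011, Thm 2.10 with Def. 2.9 and Rmk 2.11 (§2.2; HUPS preprint #956 pp. 10–11)] -/
def gigaMiura2011_local_continuousAlignment_typeI : Prop :=
  ∀ ⦃u : ℝ → EuclideanSpace ℝ (Fin 3) → EuclideanSpace ℝ (Fin 3)⦄
    ⦃p : ℝ → EuclideanSpace ℝ (Fin 3) → ℝ⦄ ⦃r₀ C₀ : ℝ⦄,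
    IsSuitableWeakSolutionInBall 1 ((0 : ℝ), (0 : EuclideanSpace ℝ (Fin 3))) u p →
    0 < r₀ → r₀ < 1 → 0 < C₀ →
    -- the slices are `C¹` on `B(r₀)` (tacit in print) and locally Type I there
    (∀ t ∈ Ioo (-1 : ℝ) 0, ContDiffOn ℝ 1 (u t) (ball 0 r₀)) →
    (∀ t ∈ Ioo (-1 : ℝ) 0, ∀ x ∈ ball (0 : EuclideanSpace ℝ (Fin 3)) r₀,
      Real.sqrt (-t) * ‖u t x‖ ≤ C₀) →
    -- (D): continuous alignment with modulus `η` on `Ω_d(t) = {x ∈ B(r₀) : |ω(x,t)| > d}`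
    (∃ d : ℝ, 0 < d ∧ ∃ η : ℝ → ℝ, MonotoneOn η (Ici 0) ∧ ContinuousOn η (Ici 0) ∧ η 0 = 0 ∧
      ∀ t ∈ Ioo (-1 : ℝ) 0, ∀ x ∈ ball (0 : EuclideanSpace ℝ (Fin 3)) r₀,
        ∀ y ∈ ball (0 : EuclideanSpace ℝ (Fin 3)) r₀,
        d < ‖curl (u t) x‖ → d < ‖curl (u t) y‖ →
          ‖vorticityDirection (curl (u t)) x - vorticityDirection (curl (u t)) y‖ ≤ η ‖x - y‖) →
    ∃ r > 0, eLpNorm (uncurry u) ∞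
      (volume.restrict (parabolicCylinder r ((0 : ℝ), (0 : EuclideanSpace ℝ (Fin 3))))) < ∞

end Literature.Analysis.FluidPDE

end
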